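import Literature.NumberTheory.EllipticCurves.EisensteinDedekindMeasureTwo
import Literature.NumberTheory.EllipticCurves.PAdicLFunctionTameDepletionFactorProofs
import Literature.NumberTheory.EllipticCurves.GreenbergVatsal2000.NonPrimitivePAdicLFunction
import Literature.NumberTheory.EllipticCurves.PAdicLFunctionDistributionProofs
import Literature.NumberTheory.EllipticCurves.BurungaleSkinner2023.RootNumberLambdaParityProofs
import HarnessLib

/-!
# Euler-factor DEPLETION of a bounded distribution on `ℤ_p^×` at a place `ℓ ≠ p`: the operator
# `P_ℓ(E, ℓ⁻¹[ℓ]^*)` and its transform `𝒫_ℓ^ι · L_μ` (Greenberg–Vatsal 2000 §1 (8)–(10), §2 Prop. (2.4);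
# Emerton–Pollack–Weston 2006 §3), with the companion operator on modular-symbol tables

Greenberg–Vatsal (Invent. Math. 142 (2000), §1 p. 9 and Prop. (2.4)) and Emerton–Pollack–Weston (Invent. Math. 163 (2006), §3)
pass from the `p`-adic `L`-function `L_p(f)` to the `Σ₀`-DEPLETED one `L_{Σ₀}(f) = L_p(f) · ∏_{ℓ∈Σ₀} 𝒫_ℓ` by removing Euler factors;
on the side of measures / modular symbols this is the action of the element `P_ℓ(E, ℓ⁻¹σ_ℓ)` of the completed group ring, `σ_ℓ` the
pull-back along multiplication by `ℓ` on `ℤ_p^×` (EPW §3.4–3.5: the symbol of the `ℓ`-stabilised form `f^{(ℓ)}` is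
`φ_f − a_ℓ ℓ⁻¹ φ_f|[ℓ] + ε(ℓ)ℓ⁻¹ φ_f|[ℓ²]`, `(φ|[d])(x) = φ(d x)`). This file defines that operator for the tree's abstract distributions
(`codilate`, `distributionTransform` of `KubotaLeopoldtTwoNumerator` / `PAdicMeasureConvolutionProofs`) and proves, for every prime `p`
and every place `v = (ℓ)`, `ℓ ≠ p`, with `P_v = W.localPolynomialAt v = Σ_i c_i X^i`:

* `eulerDeplete W p v μ = Σ_i (c_i ℓ^{-i}) • [ℓ^i]^* μ` (§1) preserves the distribution relation, bounds and evenness (§2);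
* **`distributionTransform_eulerDeplete`** (§3): `L_{P_v(ℓ⁻¹[ℓ]^*)μ} = ι(𝒫_v^ι) · L_μ` with `𝒫_v^ι = P_v(ℓ⁻¹(1+T)^{−f_ℓ}) =
  GreenbergVatsal2000.eulerFactorElementInv W p v` — the tree-ORIENTED Euler-factor element (module note «ORIENTATION of `T`» of
  `NonPrimitivePAdicLFunction`; pull-back by `ℓ` multiplies the transform by `(1+T)^{−f_ℓ}`, `distributionTransform_codilate`), for ANY
  reduction type at `v` (no case analysis: the identity is `aeval`-functorial in `P_v`);
* the iterate over a list of places `eulerDepleteList` and `L = ι(∏ 𝒫_v^ι) · L_μ` (§4);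
* the companion operator on symbol tables `eulerDepleteTable W v φ (x) = Σ_i c_i ℓ^{-i} φ(ℓ^i x)` (§5): for the Mazur–Swinnerton-Dyer
  measure `μ_{f,α}` of a cusp form, `eulerDepleteList W p l (msdMeasure f α)` at a positive level is the Mazur–Swinnerton-Dyer expression
  in the DEPLETED table `eulerDepleteTableList W l [·]⁺_f` (`eulerDepleteList_msdMeasure_succ`), and the table keeps `ℤ`-periodicity and
  any bound on the `p`-power cusps.

Everything is proved (definitions with bodies + theorems; no named fact, no instance, no notation). USE: cell `bsd-f1-sign2`, crux
`MainConjectureTransportAlignedAtTwo` (stmt-BirchSwinnertonDyer-22296), where at `p = 2` the raw `Σ`-depleted identity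
`red (G₁·∏𝒫^ι(W₁)) = red (G₂·∏𝒫^ι(W₂))` is thereby reduced to a parity law for the depleted plus-symbol tables on the `2`-power cusps.

References: [GreenbergVatsal2000] §1 pp. 8–9 (displays (8)–(10)), §2 Prop. (2.4); [EmertonPollackWeston2006] §3 (3.4)–(3.5);
[MazurTateTeitelbaum1986Invent] §I.10 (10.1), §I.13; [LangCyclotomic1990] Ch. 4 §2 (operations on measures).
-/

noncomputable section

open scoped Classical

open Filter Topology NumberField IsDedekindDomain WeierstrassCurve PowerSeries
open Literature.NumberTheory.EllipticCurves Literature.NumberTheory.EllipticCurves.ModularForms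

namespace Literature.NumberTheory.EllipticCurves.GreenbergVatsal2000

/-! ## §1 The depletion weights and the operator `P_v(ℓ⁻¹[ℓ]^*)` -/

section Defs

variable (W : WeierstrassCurve ℚ) (p : ℕ) [Fact p.Prime] (v : HeightOneSpectrum (𝓞 ℚ))

/-- The `i`-th **depletion weight** `c_i · ℓ^{-i} ∈ ℚ` of the place `v = (ℓ)`, `P_v(X) = Σ_i c_i X^i = W.localPolynomialAt v`
(`1 − a_ℓX + ℓX²`, `1 ∓ X`, `1` by reduction type): the coefficient of `[ℓ^i]^*` in `P_v(ℓ⁻¹[ℓ]^*)`.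
[cite: GreenbergVatsal2000, §2 Prop. (2.4) (𝒫_ℓ = P_ℓ(ℓ⁻¹γ_ℓ))] [cite: EmertonPollackWeston2006, §3 (3.4)–(3.5)] -/
def eulerDepletionWeight (i : ℕ) : ℚ :=
  ((W.localPolynomialAt v).coeff i : ℚ) * ((Rat.HeightOneSpectrum.natGenerator v : ℚ)⁻¹) ^ i

/-- **Euler-factor depletion of a distribution at `v = (ℓ)`**: `P_v(ℓ⁻¹[ℓ]^*) μ = Σ_i (c_i ℓ^{-i}) • [ℓ^i]^* μ`, where
`([c]^*μ)(a + pⁿℤ_p) = μ(ac + pⁿℤ_p)` is the pull-back `codilate`. [cite: GreenbergVatsal2000, §1 p. 9 (display (8)) and §2 Prop. (2.4)]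
[cite: EmertonPollackWeston2006, §3 (3.4)–(3.5)] -/
def eulerDeplete (μ : (n : ℕ) → ZMod (p ^ n) → ℚ_[p]) : (n : ℕ) → ZMod (p ^ n) → ℚ_[p] :=
  ∑ i ∈ Finset.range ((W.localPolynomialAt v).natDegree + 1),
    ((eulerDepletionWeight W v i : ℚ) : ℚ_[p]) • codilate (Rat.HeightOneSpectrum.natGenerator v ^ i) μ

/-- **Depletion over a list of places** (iterate of `eulerDeplete`; the operators at different places commute, so for a
duplicate-free list this is `∏_{v ∈ l} P_v(ℓ_v⁻¹[ℓ_v]^*)`). [cite: GreenbergVatsal2000, §1 p. 9 (display (8))] -/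
def eulerDepleteList (l : List (HeightOneSpectrum (𝓞 ℚ))) (μ : (n : ℕ) → ZMod (p ^ n) → ℚ_[p]) :
    (n : ℕ) → ZMod (p ^ n) → ℚ_[p] :=
  l.foldr (eulerDeplete W p) μ

/-- **Euler-factor depletion of a symbol table** `φ : ℚ → ℚ` at `v = (ℓ)`: `(P_v(ℓ⁻¹[ℓ]) φ)(x) = Σ_i c_i ℓ^{-i} φ(ℓ^i x)` — the
modular symbol of the `ℓ`-depleted form in terms of that of `f` (EPW (3.4)–(3.5): `{∞, x}_{f(ℓ·)} = ℓ⁻¹{∞, ℓx}_f`).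
[cite: EmertonPollackWeston2006, §3 (3.4)–(3.5)] -/
def eulerDepleteTable (φ : ℚ → ℚ) : ℚ → ℚ :=
  fun x ↦ ∑ i ∈ Finset.range ((W.localPolynomialAt v).natDegree + 1),
    eulerDepletionWeight W v i * φ ((Rat.HeightOneSpectrum.natGenerator v : ℚ) ^ i * x)

/-- Depletion of a symbol table over a list of places (iterate of `eulerDepleteTable`). [cite: EmertonPollackWeston2006, §3 (3.4)–(3.5)] -/
def eulerDepleteTableList (l : List (HeightOneSpectrum (𝓞 ℚ))) (φ : ℚ → ℚ) : ℚ → ℚ :=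
  l.foldr (eulerDepleteTable W) φ

/-- Unfolding of `eulerDepleteList` on `v :: l`. [folklore] -/
private theorem eulerDepleteList_cons (v₀ : HeightOneSpectrum (𝓞 ℚ)) (l : List (HeightOneSpectrum (𝓞 ℚ)))
    (μ : (n : ℕ) → ZMod (p ^ n) → ℚ_[p]) :
    eulerDepleteList W p (v₀ :: l) μ = eulerDeplete W p v₀ (eulerDepleteList W p l μ) :=
  rfl

/-- Unfolding of `eulerDepleteList` on `[]`. [folklore] -/
private theorem eulerDepleteList_nil (μ : (n : ℕ) → ZMod (p ^ n) → ℚ_[p]) : eulerDepleteList W p [] μ = μ :=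
  rfl

/-- Unfolding of `eulerDepleteTableList` on `v :: l`. [folklore] -/
private theorem eulerDepleteTableList_cons (v₀ : HeightOneSpectrum (𝓞 ℚ)) (l : List (HeightOneSpectrum (𝓞 ℚ))) (φ : ℚ → ℚ) :
    eulerDepleteTableList W (v₀ :: l) φ = eulerDepleteTable W v₀ (eulerDepleteTableList W l φ) :=
  rfl

/-- Unfolding of `eulerDepleteTableList` on `[]`. [folklore] -/
private theorem eulerDepleteTableList_nil (φ : ℚ → ℚ) : eulerDepleteTableList W [] φ = φ :=
  rfl

/-- Pointwise unfolding of `eulerDeplete`. [folklore] -/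
private theorem eulerDeplete_apply (μ : (n : ℕ) → ZMod (p ^ n) → ℚ_[p]) (n : ℕ) (a : ZMod (p ^ n)) :
    eulerDeplete W p v μ n a =
      ∑ i ∈ Finset.range ((W.localPolynomialAt v).natDegree + 1),
        ((eulerDepletionWeight W v i : ℚ) : ℚ_[p]) * μ n (a * ((Rat.HeightOneSpectrum.natGenerator v ^ i : ℕ) : ZMod (p ^ n))) := by
  simp only [eulerDeplete, Finset.sum_apply, Pi.smul_apply, smul_eq_mul, codilate_apply]

end Defs

/-! ## §2 The depletion preserves the distribution relation, bounds and evenness -/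

section Basic

variable (W : WeierstrassCurve ℚ) {p : ℕ} [Fact p.Prime] (v : HeightOneSpectrum (𝓞 ℚ))
  {μ : (n : ℕ) → ZMod (p ^ n) → ℚ_[p]}

/-- The prime under a place is prime. [folklore] -/
private theorem natGenerator_prime : (Rat.HeightOneSpectrum.natGenerator v).Prime :=
  (Rat.HeightOneSpectrum.primesEquiv v).2

/-- The prime `ℓ` under `v` is a unit of `ℤ_p` when `ℓ ≠ p`. [folklore] -/
private theorem isUnit_natGenerator (hv : Rat.HeightOneSpectrum.natGenerator v ≠ p) :
    IsUnit ((Rat.HeightOneSpectrum.natGenerator v : ℕ) : ℤ_[p]) := by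
  rw [PadicInt.isUnit_iff]
  refine le_antisymm (PadicInt.norm_le_one _) (not_lt.mp fun h ↦ ?_)
  have h' : ‖((Rat.HeightOneSpectrum.natGenerator v : ℤ) : ℤ_[p])‖ < 1 := by rwa [Int.cast_natCast]
  rw [PadicInt.norm_int_lt_one_iff_dvd, Int.natCast_dvd_natCast] at h'
  exact hv (((Nat.prime_dvd_prime_iff_eq Fact.out (natGenerator_prime v)).mp h').symm)

/-- `‖ℓ‖_p = 1` in `ℚ_p` for the prime `ℓ ≠ p` under `v`. [folklore] -/
private theorem norm_natGenerator_eq_one (hv : Rat.HeightOneSpectrum.natGenerator v ≠ p) :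
    ‖((Rat.HeightOneSpectrum.natGenerator v : ℕ) : ℚ_[p])‖ = 1 := by
  rw [← PadicInt.coe_natCast, PadicInt.padic_norm_e_of_padicInt]
  exact PadicInt.isUnit_iff.mp (isUnit_natGenerator v hv)

/-- **The depletion weights are `p`-integral** for `ℓ ≠ p` (`c_i ∈ ℤ`, `ℓ` a `p`-adic unit). [folklore] -/
private theorem norm_eulerDepletionWeight_le_one (hv : Rat.HeightOneSpectrum.natGenerator v ≠ p) (i : ℕ) :
    ‖((eulerDepletionWeight W v i : ℚ) : ℚ_[p])‖ ≤ 1 := by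
  rw [eulerDepletionWeight]
  push_cast
  rw [norm_mul, norm_pow, norm_inv, norm_natGenerator_eq_one v hv, inv_one, one_pow, mul_one]
  exact_mod_cast Padic.norm_int_le_one (p := p) ((W.localPolynomialAt v).coeff i)

/-- **`P_v(ℓ⁻¹[ℓ]^*)` preserves the distribution relation** (`ℓ ≠ p`; each `[ℓ^i]^*` does, `codilate_distribution`).
[cite: LangCyclotomic1990, Ch. 4 §2 (PDF pp. 80–82)] -/
private theorem eulerDeplete_distribution (hv : Rat.HeightOneSpectrum.natGenerator v ≠ p)
    (hμ : ∀ (n : ℕ) (a : ZMod (p ^ n)),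
      ∑ b ∈ Finset.univ.filter (fun b : ZMod (p ^ (n + 1)) ↦
        ZMod.castHom (pow_dvd_pow p n.le_succ) (ZMod (p ^ n)) b = a), μ (n + 1) b = μ n a)
    (n : ℕ) (a : ZMod (p ^ n)) :
    ∑ b ∈ Finset.univ.filter (fun b : ZMod (p ^ (n + 1)) ↦
        ZMod.castHom (pow_dvd_pow p n.le_succ) (ZMod (p ^ n)) b = a), eulerDeplete W p v μ (n + 1) b =
      eulerDeplete W p v μ n a := by
  have hcop : ∀ i : ℕ, p.Coprime (Rat.HeightOneSpectrum.natGenerator v ^ i) := fun i ↦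
    Nat.Coprime.pow_right i ((Nat.coprime_primes Fact.out (natGenerator_prime v)).mpr (Ne.symm hv))
  simp only [eulerDeplete, Finset.sum_apply, Pi.smul_apply, smul_eq_mul]
  rw [Finset.sum_comm]
  refine Finset.sum_congr rfl fun i _ ↦ ?_
  rw [← Finset.mul_sum, codilate_distribution (hcop i) hμ n a]

/-- **`P_v(ℓ⁻¹[ℓ]^*)` preserves bounds** (`ℓ ≠ p`; the weights are `p`-integral, ultrametric inequality). [folklore] -/
private theorem norm_eulerDeplete_le (hv : Rat.HeightOneSpectrum.natGenerator v ≠ p) {C : ℝ}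
    (hC : ∀ (n : ℕ) (a : ZMod (p ^ n)), ‖μ n a‖ ≤ C) (n : ℕ) (a : ZMod (p ^ n)) :
    ‖eulerDeplete W p v μ n a‖ ≤ C := by
  have hC0 : 0 ≤ C := (norm_nonneg _).trans (hC 0 0)
  rw [eulerDeplete_apply]
  refine IsUltrametricDist.norm_sum_le_of_forall_le_of_nonneg hC0 fun i _ ↦ ?_
  rw [norm_mul]
  calc _ ≤ 1 * C := mul_le_mul (norm_eulerDepletionWeight_le_one W v hv i) (hC _ _) (norm_nonneg _) zero_le_one
    _ = C := one_mul C

/-- **`P_v(ℓ⁻¹[ℓ]^*)` preserves evenness** (`codilate_neg`). [folklore] -/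
private theorem eulerDeplete_neg (hμ : ∀ (n : ℕ) (a : ZMod (p ^ n)), μ n (-a) = μ n a) (n : ℕ) (a : ZMod (p ^ n)) :
    eulerDeplete W p v μ n (-a) = eulerDeplete W p v μ n a := by
  rw [eulerDeplete_apply, eulerDeplete_apply]
  refine Finset.sum_congr rfl fun i _ ↦ ?_
  rw [neg_mul, hμ]

end Basic

/-! ## §3 The transform: `L_{P_v(ℓ⁻¹[ℓ]^*)μ} = ι(𝒫_v^ι) · L_μ` -/

section Transform

variable (W : WeierstrassCurve ℚ) {p : ℕ} [Fact p.Prime] (v : HeightOneSpectrum (𝓞 ℚ))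
  {μ : (n : ℕ) → ZMod (p ^ n) → ℚ_[p]}

/-- `f_{ℓ^i} = i · f_ℓ` for the Greenberg–Vatsal exponent of a `p`-adic unit `ℓ` (`ell` is a homomorphism, `ell_mul`). [folklore] -/
private theorem frobeniusExponent_pow {x : ℤ_[p]} (hx : IsUnit x) (i : ℕ) :
    frobeniusExponent p (x ^ i) = i * frobeniusExponent p x := by
  induction i with
  | zero =>
    rw [pow_zero, Nat.cast_zero, zero_mul, frobeniusExponent_of_isUnit isUnit_one]
    have h := CyclotomicZp.ell_mul p 1 1
    rw [mul_one] at h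
    have h1 : (isUnit_one : IsUnit (1 : ℤ_[p])).unit = 1 := Units.ext rfl
    rw [h1]
    linear_combination -h
  | succ i ih =>
    have hxi : IsUnit (x ^ i) := hx.pow i
    have hxi1 : IsUnit (x ^ (i + 1)) := hx.pow (i + 1)
    rw [frobeniusExponent_of_isUnit hxi1, Nat.cast_succ, add_mul, one_mul, ← ih, frobeniusExponent_of_isUnit hxi,
      frobeniusExponent_of_isUnit hx, ← CyclotomicZp.ell_mul]
    congr 1
    exact Units.ext (by simp [pow_succ])

/-- `ι(ℓ⁻¹) = ℓ⁻¹`: the `ℤ_p`-inverse of the unit `ℓ` maps to the inverse in `ℚ_p`. [folklore] -/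
private theorem coe_inv_natGenerator (hv : Rat.HeightOneSpectrum.natGenerator v ≠ p) :
    (((Rat.HeightOneSpectrum.natGenerator v : ℕ) : ℤ_[p]).inv : ℚ_[p]) = ((Rat.HeightOneSpectrum.natGenerator v : ℕ) : ℚ_[p])⁻¹ := by
  have hu := isUnit_natGenerator v hv
  have h1 : ((Rat.HeightOneSpectrum.natGenerator v : ℕ) : ℤ_[p]) * ((Rat.HeightOneSpectrum.natGenerator v : ℕ) : ℤ_[p]).inv = 1 :=
    PadicInt.mul_inv (PadicInt.isUnit_iff.mp hu)
  have h2 : ((Rat.HeightOneSpectrum.natGenerator v : ℕ) : ℚ_[p]) * ((((Rat.HeightOneSpectrum.natGenerator v : ℕ) : ℤ_[p]).inv : ℤ_[p]) : ℚ_[p]) = 1 := by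
    have h := congrArg ((↑) : ℤ_[p] → ℚ_[p]) h1
    push_cast at h
    exact h
  exact eq_inv_of_mul_eq_one_right h2

/-- **The transform of the depleted distribution**: for a bounded distribution `μ` on `ℤ_p` (distribution relation `hμ`, bound
`hC`) and a place `v = (ℓ)` with `ℓ ≠ p`, `L_{P_v(ℓ⁻¹[ℓ]^*)μ}(T) = ι(𝒫_v^ι(T)) · L_μ(T)` in `ℚ_p⟦T⟧`, where
`𝒫_v^ι = P_v(ℓ⁻¹(1+T)^{−f_ℓ}) = eulerFactorElementInv W p v` is Greenberg–Vatsal's Euler-factor element in the tree's orientation.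
Mechanism: `[ℓ^i]^*` multiplies the transform by `(1+T)^{−f_{ℓ^i}} = ((1+T)^{−f_ℓ})^i` (`distributionTransform_codilate`,
`exists_teichmuller_frobeniusExponent`, `ell_mul`), the transform is linear (`distributionTransform_finset_sum_smul`), and
`Σ_i c_i ℓ^{-i} ((1+T)^{−f_ℓ})^i = P_v(ℓ⁻¹(1+T)^{−f_ℓ})` (`Polynomial.aeval_eq_sum_range`). No case analysis on the reduction type.
[cite: GreenbergVatsal2000, §1 pp. 8–9 (displays (8)–(10)) and §2 Prop. (2.4)] [cite: EmertonPollackWeston2006, §3 (3.4)–(3.5)] -/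
theorem distributionTransform_eulerDeplete (hv : Rat.HeightOneSpectrum.natGenerator v ≠ p)
    (hμ : ∀ (n : ℕ) (a : ZMod (p ^ n)),
      ∑ b ∈ Finset.univ.filter (fun b : ZMod (p ^ (n + 1)) ↦
        ZMod.castHom (pow_dvd_pow p n.le_succ) (ZMod (p ^ n)) b = a), μ (n + 1) b = μ n a)
    {C : ℝ} (hC : ∀ (n : ℕ) (a : ZMod (p ^ n)), ‖μ n a‖ ≤ C) :
    distributionTransform (eulerDeplete W p v μ) =
      iwasawaToPowerSeries p (eulerFactorElementInv W p v) * distributionTransform μ := by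
  set ℓ : ℕ := Rat.HeightOneSpectrum.natGenerator v with hℓ
  set fℓ : ℤ_[p] := frobeniusExponent p (ℓ : ℤ_[p]) with hfℓ
  have hℓp : ℓ.Coprime p := (Nat.coprime_primes (natGenerator_prime v) Fact.out).mpr hv
  have hu : IsUnit ((ℓ : ℕ) : ℤ_[p]) := isUnit_natGenerator v hv
  -- `(1+T)^{−i f} = ((1+T)^{−f})^i`
  have hpow : ∀ i : ℕ, PowerSeries.binomialSeries ℚ_[p] (-((i : ℤ_[p]) * fℓ)) = PowerSeries.binomialSeries ℚ_[p] (-fℓ) ^ i := by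
    intro i
    induction i with
    | zero => rw [Nat.cast_zero, zero_mul, neg_zero, PowerSeries.binomialSeries_zero, pow_zero]
    | succ i ih => rw [Nat.cast_succ, add_mul, one_mul, neg_add, PowerSeries.binomialSeries_add, ih, pow_succ]
  -- the transform of each pull-back `[ℓ^i]^* μ`
  have hcod : ∀ i : ℕ, distributionTransform (codilate (ℓ ^ i) μ) =
      PowerSeries.binomialSeries ℚ_[p] (-fℓ) ^ i * distributionTransform μ := by
    intro i
    obtain ⟨teich, hteich⟩ := exists_teichmuller_frobeniusExponent (p := p) (ℓ := ℓ ^ i) (Nat.Coprime.pow_left i hℓp)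
    have hexp : frobeniusExponent p ((ℓ ^ i : ℕ) : ℤ_[p]) = i * fℓ := by
      rw [Nat.cast_pow, frobeniusExponent_pow hu i]
    rw [hexp] at hteich
    rw [distributionTransform_codilate hteich hμ hC, hpow]
  -- linearity of the transform
  have hlin := distributionTransform_finset_sum_smul (Finset.range ((W.localPolynomialAt v).natDegree + 1))
    (fun i ↦ ((eulerDepletionWeight W v i : ℚ) : ℚ_[p])) (fun i ↦ codilate (ℓ ^ i) μ)
    (fun i _ ↦ codilate_distribution (Nat.Coprime.pow_right i hℓp.symm) hμ) (fun i _ ↦ ⟨C, norm_codilate_le _ hC⟩)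
  rw [eulerDeplete, ← hℓ, hlin]
  simp_rw [hcod, ← mul_assoc, ← Finset.sum_mul]
  congr 1
  -- the Euler-factor element as the same sum
  have hC' : iwasawaToPowerSeries p (PowerSeries.C (((ℓ : ℕ) : ℤ_[p]).inv)) = PowerSeries.C ((ℓ : ℚ_[p])⁻¹) := by
    rw [iwasawaToPowerSeries, PowerSeries.map_C, PadicInt.algebraMap_apply, coe_inv_natGenerator v hv]
  rw [eulerFactorElementInv_eq, ← hℓ, Polynomial.aeval_eq_sum_range, map_sum]
  refine Finset.sum_congr rfl fun i _ ↦ ?_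
  rw [Algebra.smul_def, eq_intCast, map_mul, map_intCast, map_pow, map_mul,
    BurungaleSkinner2023.iwasawaToPowerSeries_binomialSeries, ← hfℓ, hC', ← map_intCast (PowerSeries.C (R := ℚ_[p])),
    eulerDepletionWeight, ← hℓ]
  push_cast
  rw [map_mul, map_pow, mul_pow, ← map_pow, mul_assoc]

end Transform

/-! ## §4 Iteration over a list of places -/

section List

variable (W : WeierstrassCurve ℚ) {p : ℕ} [Fact p.Prime]

/-- The iterated depletion preserves the distribution relation, bounds and evenness, and has transform
`ι(∏_{v ∈ l} 𝒫_v^ι) · L_μ` (`l` a list of places prime to `p`). [cite: GreenbergVatsal2000, §1 p. 9 (display (8)) and §2 Prop. (2.4)] -/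
theorem eulerDepleteList_spec (l : List (HeightOneSpectrum (𝓞 ℚ)))
    (hl : ∀ v ∈ l, Rat.HeightOneSpectrum.natGenerator v ≠ p)
    {μ : (n : ℕ) → ZMod (p ^ n) → ℚ_[p]}
    (hμ : ∀ (n : ℕ) (a : ZMod (p ^ n)),
      ∑ b ∈ Finset.univ.filter (fun b : ZMod (p ^ (n + 1)) ↦
        ZMod.castHom (pow_dvd_pow p n.le_succ) (ZMod (p ^ n)) b = a), μ (n + 1) b = μ n a)
    {C : ℝ} (hC : ∀ (n : ℕ) (a : ZMod (p ^ n)), ‖μ n a‖ ≤ C) :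
    (∀ (n : ℕ) (a : ZMod (p ^ n)),
      ∑ b ∈ Finset.univ.filter (fun b : ZMod (p ^ (n + 1)) ↦
        ZMod.castHom (pow_dvd_pow p n.le_succ) (ZMod (p ^ n)) b = a), eulerDepleteList W p l μ (n + 1) b =
      eulerDepleteList W p l μ n a) ∧
    (∀ (n : ℕ) (a : ZMod (p ^ n)), ‖eulerDepleteList W p l μ n a‖ ≤ C) ∧
    distributionTransform (eulerDepleteList W p l μ) =
      iwasawaToPowerSeries p ((l.map (eulerFactorElementInv W p)).prod) * distributionTransform μ := by
  induction l with
  | nil =>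
    refine ⟨hμ, hC, ?_⟩
    rw [eulerDepleteList_nil, List.map_nil, List.prod_nil, map_one, one_mul]
  | cons v₀ l ih =>
    obtain ⟨hd, hb, ht⟩ := ih (fun v hv ↦ hl v (List.mem_cons_of_mem _ hv))
    have hv₀ := hl v₀ (List.mem_cons_self)
    refine ⟨fun n a ↦ ?_, fun n a ↦ ?_, ?_⟩
    · rw [eulerDepleteList_cons]; exact eulerDeplete_distribution W v₀ hv₀ hd n a
    · rw [eulerDepleteList_cons]; exact norm_eulerDeplete_le W v₀ hv₀ hb n a
    · rw [eulerDepleteList_cons, distributionTransform_eulerDeplete W v₀ hv₀ hd hb, ht, List.map_cons, List.prod_cons, map_mul,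
        mul_assoc]

/-- The iterated depletion of an even set function is even (pull-backs and linear combinations preserve evenness).
[cite: LangCyclotomic1990, Ch. 4 §2 (operations on measures, PDF pp. 80–82)] -/
theorem eulerDepleteList_neg (l : List (HeightOneSpectrum (𝓞 ℚ))) {μ : (n : ℕ) → ZMod (p ^ n) → ℚ_[p]}
    (hμ : ∀ (n : ℕ) (a : ZMod (p ^ n)), μ n (-a) = μ n a) :
    ∀ (n : ℕ) (a : ZMod (p ^ n)), eulerDepleteList W p l μ n (-a) = eulerDepleteList W p l μ n a := by
  induction l with
  | nil => exact hμ
  | cons v₀ l ih => intro n a; rw [eulerDepleteList_cons]; exact eulerDeplete_neg W v₀ ih n a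

end List

/-! ## §5 The companion operator on symbol tables and the Mazur–Swinnerton-Dyer measure -/

section Table

variable (W : WeierstrassCurve ℚ) {p : ℕ} [Fact p.Prime]

/-- The depleted table of a `ℤ`-periodic table is `ℤ`-periodic. [folklore] -/
private theorem eulerDepleteTableList_add_intCast (l : List (HeightOneSpectrum (𝓞 ℚ))) {φ : ℚ → ℚ}
    (hφ : ∀ (x : ℚ) (z : ℤ), φ (x + z) = φ x) :
    ∀ (x : ℚ) (z : ℤ), eulerDepleteTableList W l φ (x + z) = eulerDepleteTableList W l φ x := by
  induction l with
  | nil => exact hφ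
  | cons v₀ l ih =>
    intro x z
    rw [eulerDepleteTableList_cons]
    simp only [eulerDepleteTable]
    refine Finset.sum_congr rfl fun i _ ↦ ?_
    have h : (Rat.HeightOneSpectrum.natGenerator v₀ : ℚ) ^ i * (x + z) =
        (Rat.HeightOneSpectrum.natGenerator v₀ : ℚ) ^ i * x + ((Rat.HeightOneSpectrum.natGenerator v₀ ^ i * z : ℤ) : ℚ) := by
      push_cast; ring
    rw [h, ih]

/-- **A bound on the `p`-power cusps is preserved by the depletion** (`ℓ ≠ p` for every place of the list): if
`‖φ(m/pᵏ)‖_p ≤ B` for all `m, k` then the same holds for the depleted table (`ℓ^i · m/pᵏ = (ℓ^i m)/pᵏ`, integral weights,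
ultrametric inequality) — the elementary integrality bookkeeping of the `ℓ`-stabilised symbol.
[cite: EmertonPollackWeston2006, §3 (3.4)–(3.5)] -/
theorem norm_eulerDepleteTableList_le (l : List (HeightOneSpectrum (𝓞 ℚ)))
    (hl : ∀ v ∈ l, Rat.HeightOneSpectrum.natGenerator v ≠ p) {φ : ℚ → ℚ} {B : ℝ} (hB : 0 ≤ B)
    (hφ : ∀ m k : ℕ, ‖((φ ((m : ℚ) / (p : ℚ) ^ k) : ℚ) : ℚ_[p])‖ ≤ B) :
    ∀ m k : ℕ, ‖((eulerDepleteTableList W l φ ((m : ℚ) / (p : ℚ) ^ k) : ℚ) : ℚ_[p])‖ ≤ B := by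
  induction l with
  | nil => exact hφ
  | cons v₀ l ih =>
    intro m k
    have hv₀ := hl v₀ (List.mem_cons_self)
    have ih' := ih (fun v hv ↦ hl v (List.mem_cons_of_mem _ hv))
    rw [eulerDepleteTableList_cons]
    simp only [eulerDepleteTable]
    push_cast
    refine IsUltrametricDist.norm_sum_le_of_forall_le_of_nonneg hB fun i _ ↦ ?_
    have harg : (Rat.HeightOneSpectrum.natGenerator v₀ : ℚ) ^ i * ((m : ℚ) / (p : ℚ) ^ k) =
        ((Rat.HeightOneSpectrum.natGenerator v₀ ^ i * m : ℕ) : ℚ) / (p : ℚ) ^ k := by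
      push_cast; ring
    rw [norm_mul, harg]
    calc _ ≤ 1 * B := mul_le_mul (by exact_mod_cast norm_eulerDepletionWeight_le_one W v₀ hv₀ i) (ih' _ _) (norm_nonneg _)
          zero_le_one
      _ = B := one_mul B

variable {N : ℕ} [NeZero N] (f : CuspForm (CongruenceSubgroup.Gamma0 N) 2)

/-- **The depleted Mazur–Swinnerton-Dyer measure is the Mazur–Swinnerton-Dyer expression in the depleted table**: at every positive
level, `(∏ P_v(ℓ⁻¹[ℓ]^*)) μ_{f,α} (a + p^{n+1}ℤ_p) = α^{−(n+1)} Φ(a/p^{n+1}) − α^{−(n+2)} Φ(a/pⁿ)` with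
`Φ = eulerDepleteTableList W l [·]⁺_f` (translation invariance `[r + 1]⁺ = [r]⁺`, `ratPlusSymbol_add_intCast_eq`, moves the
representative of `a·ℓ^i`). [cite: MazurTateTeitelbaum1986Invent, §I.10 (10.1)] [cite: EmertonPollackWeston2006, §3 (3.4)–(3.5)] -/
theorem eulerDepleteList_msdMeasure_succ (l : List (HeightOneSpectrum (𝓞 ℚ))) (α : ℚ_[p]) :
    ∀ (n : ℕ) (a : ZMod (p ^ (n + 1))),
      eulerDepleteList W p l (msdMeasure f α) (n + 1) a =
        α⁻¹ ^ (n + 1) * ((eulerDepleteTableList W l (ratPlusSymbol f) ((a.val : ℚ) / (p : ℚ) ^ (n + 1)) : ℚ) : ℚ_[p]) -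
          α⁻¹ ^ (n + 2) * ((eulerDepleteTableList W l (ratPlusSymbol f) ((a.val : ℚ) / (p : ℚ) ^ n) : ℚ) : ℚ_[p]) := by
  induction l with
  | nil => intro n a; rfl
  | cons v₀ l ih =>
    intro n a
    have hper := eulerDepleteTableList_add_intCast W l (φ := ratPlusSymbol f) (fun x z ↦ ratPlusSymbol_add_intCast_eq f x z)
    rw [eulerDepleteList_cons, eulerDeplete_apply, eulerDepleteTableList_cons]
    simp only [eulerDepleteTable]
    push_cast
    rw [Finset.mul_sum, Finset.mul_sum, ← Finset.sum_sub_distrib]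
    refine Finset.sum_congr rfl fun i _ ↦ ?_
    rw [ih n]
    -- move the representative: `(a ℓ^i).val ≡ a.val ℓ^i (mod p^{n+1})`
    set ℓ : ℕ := Rat.HeightOneSpectrum.natGenerator v₀ with hℓ
    haveI : NeZero (p ^ (n + 1)) := ⟨pow_ne_zero _ (Fact.out : p.Prime).ne_zero⟩
    have hx : ((((a * ((ℓ : ZMod (p ^ (n + 1))) ^ i)).val : ℤ) : ZMod (p ^ (n + 1)))) =
        (((a.val * ℓ ^ i : ℕ) : ℤ) : ZMod (p ^ (n + 1))) := by
      push_cast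
      rw [ZMod.natCast_zmod_val, ZMod.natCast_zmod_val]
    obtain ⟨z, hz⟩ := (ZMod.intCast_eq_intCast_iff_dvd_sub _ _ _).mp hx
    have hzQ : (((a * ((ℓ : ZMod (p ^ (n + 1))) ^ i)).val : ℚ)) = (a.val : ℚ) * (ℓ : ℚ) ^ i - (p : ℚ) ^ (n + 1) * z := by
      have hzZ : (((a * ((ℓ : ZMod (p ^ (n + 1))) ^ i)).val : ℤ)) = (a.val : ℤ) * (ℓ : ℤ) ^ i - (p : ℤ) ^ (n + 1) * z := by
        push_cast at hz ⊢
        linear_combination -hz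
      exact_mod_cast hzZ
    have hp0 : (p : ℚ) ≠ 0 := by exact_mod_cast (Fact.out : p.Prime).ne_zero
    have h1 : (((a * ((ℓ : ZMod (p ^ (n + 1))) ^ i)).val : ℚ)) / (p : ℚ) ^ (n + 1) =
        (ℓ : ℚ) ^ i * ((a.val : ℚ) / (p : ℚ) ^ (n + 1)) + ((-z : ℤ) : ℚ) := by
      rw [hzQ]; push_cast; field_simp; ring
    have h2 : (((a * ((ℓ : ZMod (p ^ (n + 1))) ^ i)).val : ℚ)) / (p : ℚ) ^ n =
        (ℓ : ℚ) ^ i * ((a.val : ℚ) / (p : ℚ) ^ n) + ((-(p * z) : ℤ) : ℚ) := by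
      rw [hzQ]; push_cast; field_simp; ring
    rw [h1, h2, hper, hper]
    ring

end Table

end Literature.NumberTheory.EllipticCurves.GreenbergVatsal2000

end
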